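import Mathlib.RingTheory.PowerSeries.Substitution
import Mathlib.RingTheory.PowerSeries.Expand
import Mathlib.RingTheory.PowerSeries.Derivative
import Mathlib.RingTheory.PowerSeries.Trunc
import Mathlib.RingTheory.PowerSeries.Order
import Mathlib.RingTheory.PowerSeries.NoZeroDivisors
import Mathlib.Algebra.Polynomial.Taylor
import Mathlib.Algebra.CharP.Frobenius
import Mathlib.Algebra.CharP.Quotient
import Mathlib.RingTheory.Ideal.Quotient.Basic
import Mathlib.NumberTheory.Padics.RingHoms
import Mathlib.RingTheory.WittVector.Identities
import Mathlib.RingTheory.WittVector.Domain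
import Mathlib.FieldTheory.Perfect
import Literature.NumberTheory.EllipticCurves.DivisionPolynomialFormalMulProofs
import Literature.NumberTheory.EllipticCurves.FormalGroupHasseInvariantProofs
import Literature.RingTheory.FormalGroups.FunctionalEquationIntegrality
import Literature.NumberTheory.EllipticCurves.FormalGroupMultiplicationUniversalProofs
import Literature.NumberTheory.EllipticCurves.FormalGroupLogHomProofs
import Literature.RingTheory.FormalGroups.HondaTypeTransport
import Literature.NumberTheory.EllipticCurves.FormalMulTwoSecondCoeffProofs
import Mathlib.RingTheory.WittVector.FrobeniusFractionField
import Mathlib.RingTheory.WittVector.Compare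
import Mathlib.FieldTheory.Finite.Basic
import Literature.NumberTheory.EllipticCurves.FormalLogExpBaseChangeProofs
import Summits.BirchSwinnertonDyer.BirchSwinnertonDyer.Theorems.EisensteinDepletionAtTwoStarGO2KEtaSqDescentExp
import HarnessLib

/-!
# THEOREM K (the 2-adic Kummer class law for `z²(x(z) − x₀)`), kernel formalisation — KEtaHondaTheoremKWitt
(crux `StarGO2Sigma`, stmt-BirchSwinnertonDyer-27046; line kummer, research stub `stub_discrepancyCover`)

Planner bsd-rank2-p2 GEN 36–37's K-UNIV / K-ETA kernel files (HOME/p2/g37/lean, memo K-UNIV.md; monolith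
`KummerTheoremK_full.lean`, lean rc 0, 0 sorries), landed by the lead star-p1 GEN 12 in ≤ 400-line parts, verbatim except for
file packaging.  This part: the Honda λ-series `frobLambda` (integral, any `p`), THEOREM K in kernel form (`TheoremK.theoremK`, `theoremK_self`: any Frobenius-lift setting, comparison function supplied), and (K-h) part 1: the Witt period `period` (`frobenius_period`, `coeff_zero_period`).
Nothing here reads `r_an`; `StarGO2Sigma` / E1M / BSD are NOT proved by this file.
-/

set_option linter.dupNamespace false
set_option linter.unusedSectionVars false
set_option autoImplicit false

noncomputable section

open PowerSeries Literature.RingTheory.FormalGroups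

namespace Summit.BirchSwinnertonDyer.BirchSwinnertonDyer.Theorems.DepletionAtTwo.KEta.HondaLambda

variable {p : ℕ} [hp : Fact p.Prime]

/-- `λ_α(ℓ) := ℓ − (α/p)·ℓ(Xᵖ)`. [K-UNIV.md §2.9] -/
def frobLambda (α : ℚ_[p]) (ℓ : ℚ_[p]⟦X⟧) : ℚ_[p]⟦X⟧ :=
  ℓ - C (α / p) * expand p (prime_ne_zero p) ℓ

/-- K-UNIV kernel lemma (THEOREM K formalisation, p2 GEN 37); see the file docstring. [folklore] -/
theorem frobLambda_def (α : ℚ_[p]) (ℓ : ℚ_[p]⟦X⟧) :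
    frobLambda α ℓ = ℓ - C (α / p) * expand p (prime_ne_zero p) ℓ := rfl

/-- Coefficients of `λ`. [folklore] -/
theorem coeff_frobLambda (α : ℚ_[p]) (ℓ : ℚ_[p]⟦X⟧) (n : ℕ) :
    coeff n (frobLambda α ℓ) = coeff n ℓ - α / p * (if p ∣ n then coeff (n / p) ℓ else 0) := by
  rw [frobLambda_def, map_sub, coeff_C_mul, coeff_expand]

/-- `λ(0) = (1 − α/p)·ℓ(0)`; in particular `λ(0) = 0` when `ℓ(0) = 0`. [folklore] -/
theorem constantCoeff_frobLambda {α : ℚ_[p]} {ℓ : ℚ_[p]⟦X⟧} (h0 : constantCoeff ℓ = 0) :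
    constantCoeff (frobLambda α ℓ) = 0 := by
  rw [frobLambda_def, map_sub, map_mul, constantCoeff_expand, h0, mul_zero, sub_zero]

/-- `ℓ(Xᵖ)(Xᵖ) = ℓ(X^{p²})`. [folklore] -/
theorem expand_expand (ℓ : ℚ_[p]⟦X⟧) :
    expand p (prime_ne_zero p) (expand p (prime_ne_zero p) ℓ) =
      expand (p ^ 2) (prime_sq_ne_zero p) ℓ := by
  have key : ∀ (m : ℕ) (hm : m ≠ 0), m = p * p →
      expand m hm ℓ = expand p (prime_ne_zero p) (expand p (prime_ne_zero p) ℓ) := by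
    rintro m hm rfl; exact expand_mul p (prime_ne_zero p) p (prime_ne_zero p) ℓ
  exact (key (p ^ 2) (prime_sq_ne_zero p) (sq p)).symm

/-- **The recursion identity** `λ − α⁻¹·λ(Xᵖ) = hondaShift p a ℓ` for a root `α ≠ 0` of
`X² − aX + p` (since `α/p + 1/α = (α² + p)/(pα) = a/p`). [K-UNIV.md §2.9] -/
theorem frobLambda_sub_expand {α a : ℚ_[p]} (hα : α ≠ 0) (hroot : α ^ 2 - a * α + p = 0)
    (ℓ : ℚ_[p]⟦X⟧) :
    frobLambda α ℓ - C α⁻¹ * expand p (prime_ne_zero p) (frobLambda α ℓ) = hondaShift p a ℓ := by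
  have hp0 : (p : ℚ_[p]) ≠ 0 := Nat.cast_ne_zero.mpr hp.out.ne_zero
  have ha : a / p = α / p + α⁻¹ := by
    have h1 : a = α + p * α⁻¹ := by
      have h2 : a * α = α ^ 2 + p := by linear_combination -hroot
      calc a = a * α * α⁻¹ := by rw [mul_assoc, mul_inv_cancel₀ hα, mul_one]
        _ = (α ^ 2 + p) * α⁻¹ := by rw [h2]
        _ = α + p * α⁻¹ := by rw [add_mul, sq, mul_assoc, mul_inv_cancel₀ hα, mul_one]
    rw [h1, add_div, mul_div_cancel_left₀ _ hp0]
  rw [hondaShift_def, frobLambda_def, map_sub, map_mul, expand_C, expand_expand, ha, map_add]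
  have hinv : C α⁻¹ * C (α / (p : ℚ_[p])) = C (1 / (p : ℚ_[p])) := by
    rw [← map_mul, ← mul_div_assoc, inv_mul_cancel₀ hα]
  linear_combination (expand (p ^ 2) (prime_sq_ne_zero p) ℓ) * hinv

/-- Coefficient form of the recursion: `[Xⁿ]λ = [Xⁿ]hondaShift + α⁻¹·[X^{n/p}]λ` (`p ∣ n`), resp.
`[Xⁿ]λ = [Xⁿ]hondaShift` (`p ∤ n`). [K-UNIV.md §2.9] -/
theorem coeff_frobLambda_eq {α a : ℚ_[p]} (hα : α ≠ 0) (hroot : α ^ 2 - a * α + p = 0)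
    (ℓ : ℚ_[p]⟦X⟧) (n : ℕ) :
    coeff n (frobLambda α ℓ) = coeff n (hondaShift p a ℓ) +
      α⁻¹ * (if p ∣ n then coeff (n / p) (frobLambda α ℓ) else 0) := by
  have h := congrArg (coeff n) (frobLambda_sub_expand hα hroot ℓ)
  rw [map_sub, coeff_C_mul, coeff_expand] at h
  linear_combination h

/-- **Integrality of `λ`.** If `ℓ(0) = 0`, `hondaShift p a ℓ` has `p`-integral coefficients and
`α` is a `p`-adic unit root of `X² − aX + p`, then `λ = ℓ − (α/p)ℓ(Xᵖ)` has `p`-integral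
coefficients. [K-UNIV.md §2.9] -/
theorem norm_coeff_frobLambda_le_one {α a : ℚ_[p]} (hαn : ‖α‖ = 1) (hroot : α ^ 2 - a * α + p = 0)
    {ℓ : ℚ_[p]⟦X⟧} (h0 : constantCoeff ℓ = 0) (hH : ∀ n, ‖coeff n (hondaShift p a ℓ)‖ ≤ 1) (n : ℕ) :
    ‖coeff n (frobLambda α ℓ)‖ ≤ 1 := by
  have hα : α ≠ 0 := fun h => by rw [h, norm_zero] at hαn; exact zero_ne_one hαn
  have hαi : ‖α⁻¹‖ ≤ 1 := by rw [norm_inv, hαn, inv_one]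
  induction n using Nat.strong_induction_on with
  | _ n ih =>
    rcases Nat.eq_zero_or_pos n with rfl | hn
    · rw [coeff_zero_eq_constantCoeff, constantCoeff_frobLambda h0, norm_zero]; exact zero_le_one
    rw [coeff_frobLambda_eq hα hroot ℓ n]
    refine (Padic.nonarchimedean _ _).trans (max_le (hH n) ?_)
    split_ifs with hd
    · rw [norm_mul]
      have hlt : n / p < n := Nat.div_lt_self hn hp.out.one_lt
      calc ‖α⁻¹‖ * ‖coeff (n / p) (frobLambda α ℓ)‖ ≤ 1 * 1 :=
            mul_le_mul hαi (ih _ hlt) (norm_nonneg _) zero_le_one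
        _ = 1 := one_mul 1
    · rw [mul_zero, norm_zero]; exact zero_le_one

/-- Hence `λ` is the image of a series over `ℤ_p`. [folklore] -/
theorem exists_frobLambda_eq_map {α a : ℚ_[p]} (hαn : ‖α‖ = 1) (hroot : α ^ 2 - a * α + p = 0)
    {ℓ : ℚ_[p]⟦X⟧} (h0 : constantCoeff ℓ = 0) (hH : ∀ n, ‖coeff n (hondaShift p a ℓ)‖ ≤ 1) :
    ∃ Λ : ℤ_[p]⟦X⟧, Λ.map (PadicInt.Coe.ringHom (p := p)) = frobLambda α ℓ := by
  refine ⟨PowerSeries.mk fun n => ⟨coeff n (frobLambda α ℓ), norm_coeff_frobLambda_le_one hαn hroot h0 hH n⟩, ?_⟩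
  ext n
  rw [coeff_map, coeff_mk]
  rfl

end Summit.BirchSwinnertonDyer.BirchSwinnertonDyer.Theorems.DepletionAtTwo.KEta.HondaLambda


/-! ## ASSEMBLY: THEOREM K for `g = z²(x(z) − x₀)` modulo the existence of the comparison function -/

namespace Summit.BirchSwinnertonDyer.BirchSwinnertonDyer.Theorems.DepletionAtTwo.KEta.TheoremK

open PowerSeries

variable {O k A : Type*} [CommRing O] [CommRing k] [CharP k 2] [IsDomain k]
  [CommRing A] [Algebra ℚ A] [IsDomain A]

/-- **THEOREM K (kernel form, K-UNIV.md §2.10 minus (K-h)).** In a Frobenius-lift setting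
`(O, σ, π)` at `2` (`2` regular, `ker π = 2O`, `π∘σ = Frob∘π`), let `W/O` have `a₁` odd and a
`2`-torsion abscissa `x₀` (`ΨSq₂(x₀) = 0`) with `x₀ ≡ a₃ (mod 2)` and `2B = 4x₀² + b₂x₀ + b₄` solvable,
`[2]_W ≢ 0 (mod 2)` (ordinary reduction), and let `F₀ ∈ O⟦X⟧` be an integral structure of
`exp(c·log_W)` along an injective `φ : O →+* A` into a `ℚ`-algebra domain, with `π c₀ = 1`.  Then for
EVERY `z ∈ XO⟦X⟧` the `2`-adic square classes of `g∘z` (`g = u − x₀X² = X²(x(X) − x₀)`) and `F₀∘z`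
agree: `π δ(g∘z) · (F̄₀∘z̄)² = π δ(F₀∘z) · (ḡ∘z̄)²` for any Dwork witnesses
`φ(g∘z) = (g∘z)² + 2δ(g∘z)`, `φ(F₀∘z) = (F₀∘z)² + 2δ(F₀∘z)`. [K-UNIV.md §2.5–2.7, §2.10] -/
theorem theoremK {σ : O →+* O} {π : O →+* k}
    (h2r : ∀ a : O, 2 * a = 0 → a = 0) (hker : ∀ a : O, π a = 0 ↔ ∃ b : O, a = 2 * b)
    (hfrob : ∀ a : O, π (σ a) = π a ^ 2)
    (φ : O →+* A) (hφ : Function.Injective φ) (W : WeierstrassCurve O) {x₀ B c₀ : O} {F₀ : O⟦X⟧}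
    (hx : 4 * x₀ ^ 3 + W.b₂ * x₀ ^ 2 + 2 * W.b₄ * x₀ + W.b₆ = 0)
    (hB : 2 * B = 4 * x₀ ^ 2 + W.b₂ * x₀ + W.b₄)
    (ha1 : π W.a₁ = 1) (hx0 : π x₀ = π W.a₃) (h2 : (W.formalMul 2).map π ≠ 0)
    (hF : F₀.map φ = ExpSide.expLog (W.map φ) (φ c₀)) (hc : π c₀ = 1)
    {z δgz δFz : O⟦X⟧} (hz0 : constantCoeff z = 0)
    (hgz : Kernel.phi σ ((W.formalXMulSq - C x₀ * X ^ 2).subst z) =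
      ((W.formalXMulSq - C x₀ * X ^ 2).subst z) ^ 2 + 2 * δgz)
    (hFz : Kernel.phi σ (F₀.subst z) = (F₀.subst z) ^ 2 + 2 * δFz) :
    δgz.map π * (PowerSeries.map π (F₀.subst z)) ^ 2 =
      δFz.map π * (PowerSeries.map π ((W.formalXMulSq - C x₀ * X ^ 2).subst z)) ^ 2 := by
  obtain ⟨δg, hg⟩ := Kernel.exists_delta hker hfrob (W.formalXMulSq - C x₀ * X ^ 2)
  obtain ⟨δF, hF'⟩ := Kernel.exists_delta hker hfrob F₀
  have hsqF : (1 : O⟦X⟧) ^ 2 * F₀.subst (W.formalMul 2) = F₀ ^ 2 := by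
    rw [one_pow, one_mul, ExpSide.subst_formalMul_eq_pow_of_map φ hφ W hF 2]
  have hcF : (1 : O⟦X⟧).map π ≠ 0 := by rw [map_one]; exact one_ne_zero
  have hlog := ExpSide.hlog_of_derivative_eq (SqDescent.derivative_map_g_eq W π ha1 hx0)
    (ExpSide.derivative_map_eq_of_derivative_eq π W (ExpSide.derivative_eq_of_map φ hφ W hF) hc)
  exact Kernel.kummerClass_transfer h2r hker hfrob (W.constantCoeff_formalMul 2) h2 hz0 hg hF'
    (SqDescent.sq_descent_two' W h2r hx hB)
    (SqDescent.map_formalYTilde_mul_X_ne_zero W π ha1 hx0) hsqF hcF hlog hgz hFz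

/-- The special case `z = X` (no substitution): `D(g) = D(F₀)`, i.e. the square class of
`X²(x(X) − x₀)` itself is that of `exp(c log_W)` — the "universal" form (UNIV of the numerics).
[K-UNIV.md §2.10] -/
theorem theoremK_self {σ : O →+* O} {π : O →+* k}
    (h2r : ∀ a : O, 2 * a = 0 → a = 0) (hker : ∀ a : O, π a = 0 ↔ ∃ b : O, a = 2 * b)
    (hfrob : ∀ a : O, π (σ a) = π a ^ 2)
    (φ : O →+* A) (hφ : Function.Injective φ) (W : WeierstrassCurve O) {x₀ B c₀ : O} {F₀ : O⟦X⟧}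
    (hx : 4 * x₀ ^ 3 + W.b₂ * x₀ ^ 2 + 2 * W.b₄ * x₀ + W.b₆ = 0)
    (hB : 2 * B = 4 * x₀ ^ 2 + W.b₂ * x₀ + W.b₄)
    (ha1 : π W.a₁ = 1) (hx0 : π x₀ = π W.a₃) (h2 : (W.formalMul 2).map π ≠ 0)
    (hF : F₀.map φ = ExpSide.expLog (W.map φ) (φ c₀)) (hc : π c₀ = 1)
    {δg δF : O⟦X⟧}
    (hg : Kernel.phi σ (W.formalXMulSq - C x₀ * X ^ 2) = (W.formalXMulSq - C x₀ * X ^ 2) ^ 2 + 2 * δg)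
    (hF' : Kernel.phi σ F₀ = F₀ ^ 2 + 2 * δF) :
    δg.map π * (F₀.map π) ^ 2 = δF.map π * ((W.formalXMulSq - C x₀ * X ^ 2).map π) ^ 2 := by
  have hX : ∀ f : O⟦X⟧, f.subst (X : O⟦X⟧) = f := fun f => by
    rw [← map_algebraMap_eq_subst_X f, Algebra.algebraMap_self, map_id]; rfl
  have h := theoremK h2r hker hfrob φ hφ W hx hB ha1 hx0 h2 hF hc (z := X) (δgz := δg) (δFz := δF)
    constantCoeff_X (by rw [hX]; exact hg) (by rw [hX]; exact hF')
  simpa only [hX] using h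

end Summit.BirchSwinnertonDyer.BirchSwinnertonDyer.Theorems.DepletionAtTwo.KEta.TheoremK

/-! # PART (K-h): Witt-vector existence of the period and the comparison function -/


open PowerSeries

namespace Summit.BirchSwinnertonDyer.BirchSwinnertonDyer.Theorems.DepletionAtTwo.KEta.WittExistence

section Witt

variable (k : Type*) [Field k] [IsAlgClosed k] [CharP k 2]

/-- `ι : ℤ₂ → 𝕎(k)`, through Mathlib's `𝕎(𝔽₂) ≃ ℤ₂`. [folklore] -/
def iota : ℤ_[2] →+* WittVector 2 k :=
  (WittVector.map (ZMod.castHom (dvd_refl 2) k)).comp (WittVector.equiv 2).symm.toRingHom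

/-- K-UNIV kernel lemma (THEOREM K formalisation, p2 GEN 37); see the file docstring. [folklore] -/
theorem iota_apply (a : ℤ_[2]) :
    iota k a = WittVector.map (ZMod.castHom (dvd_refl 2) k) ((WittVector.equiv 2).symm a) := rfl

/-- `ι` is injective. [folklore] -/
theorem iota_injective : Function.Injective (iota k) := by
  intro a b hab
  rw [iota_apply, iota_apply] at hab
  apply (WittVector.equiv 2).symm.injective
  ext n
  have h := congrArg (fun x : WittVector 2 k => x.coeff n) hab
  simp only [WittVector.map_coeff] at h
  exact (ZMod.castHom (dvd_refl 2) k).injective h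

/-- `σ ∘ ι = ι` (the Frobenius of `𝕎(𝔽₂)` is the identity). [folklore] -/
theorem frobenius_iota (a : ℤ_[2]) : WittVector.frobenius (iota k a) = iota k a := by
  rw [iota_apply, WittVector.frobenius_eq_map_frobenius]
  ext n
  simp only [WittVector.map_coeff, frobenius_def]
  rw [← map_pow, ZMod.pow_card]

/-- A unit of `ℤ₂` reduces to `1 ∈ k`. [folklore] -/
theorem coeff_zero_iota {a : ℤ_[2]} (ha : IsUnit a) : (iota k a).coeff 0 = 1 := by
  have hu : IsUnit ((iota k a).coeff 0) := by
    have := (ha.map (iota k)).map (WittVector.constantCoeff : WittVector 2 k →+* k)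
    simpa using this
  rw [iota_apply, WittVector.map_coeff] at hu ⊢
  have h01 : ∀ t : ZMod 2, t = 0 ∨ t = 1 := by decide
  rcases h01 (((WittVector.equiv 2).symm a).coeff 0) with h | h
  · rw [h, map_zero] at hu; exact absurd hu not_isUnit_zero
  · rw [h, map_one]

variable {k}

/-- `x ∈ 𝕎(k)` with `x̄ = 0` is divisible by `2` (`k` perfect: `x = V(y) = V(F(F⁻¹y)) = 2F⁻¹y`).
[folklore] -/
theorem exists_eq_two_mul_of_coeff_zero {x : WittVector 2 k} (hx : x.coeff 0 = 0) :
    ∃ y : WittVector 2 k, x = 2 * y := by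
  have h2 : ((2 : ℕ) : WittVector 2 k) = 2 := Nat.cast_ofNat
  have hV : x = WittVector.verschiebung (x.shift 1) := by
    have := WittVector.eq_iterate_verschiebung (x := x) (n := 1) (fun i hi => by
      interval_cases i; exact hx)
    simpa using this
  obtain ⟨y, hy⟩ := (WittVector.frobenius_bijective 2 k).2 (x.shift 1)
  refine ⟨y, ?_⟩
  rw [hV, ← hy, WittVector.verschiebung_frobenius, mul_comm, h2]

/-- **The period.** For a unit `α ∈ ℤ₂`: `c₀ ∈ 𝕎(k)` with `σ(c₀) = c₀·ι(α)` (Mathlib's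
`frobeniusRotation` with `a₁ = 1`, `a₂ = ι α`). [K-UNIV.md §2.8] -/
def period {α : ℤ_[2]} (hα : IsUnit α) : WittVector 2 k :=
  WittVector.frobeniusRotation 2 (a₁ := (1 : WittVector 2 k)) (a₂ := iota k α)
    (by simp) (by rw [coeff_zero_iota k hα]; exact one_ne_zero)

/-- K-UNIV kernel lemma (THEOREM K formalisation, p2 GEN 37); see the file docstring. [folklore] -/
theorem frobenius_period {α : ℤ_[2]} (hα : IsUnit α) :
    WittVector.frobenius (period (k := k) hα) = period (k := k) hα * iota k α := by
  have h := WittVector.frobenius_frobeniusRotation 2 (a₁ := (1 : WittVector 2 k)) (a₂ := iota k α)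
    (by simp) (by rw [coeff_zero_iota k hα]; exact one_ne_zero)
  rwa [mul_one] at h

/-- K-UNIV kernel lemma (THEOREM K formalisation, p2 GEN 37); see the file docstring. [folklore] -/
theorem coeff_zero_period_ne_zero {α : ℤ_[2]} (hα : IsUnit α) : (period (k := k) hα).coeff 0 ≠ 0 := by
  have h := WittVector.RecursionBase.solution_nonzero 2 (a₁ := (1 : WittVector 2 k)) (a₂ := iota k α)
    (by simp) (by rw [coeff_zero_iota k hα]; exact one_ne_zero)
  simpa [period, WittVector.frobeniusRotation, WittVector.frobeniusRotationCoeff] using h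

/-- `c̄₀ = 1`. [K-UNIV.md §2.8] -/
theorem coeff_zero_period {α : ℤ_[2]} (hα : IsUnit α) : (period (k := k) hα).coeff 0 = 1 := by
  have hne := coeff_zero_period_ne_zero (k := k) hα
  have h := congrArg (fun x : WittVector 2 k => x.coeff 0) (frobenius_period (k := k) hα)
  simp only [WittVector.coeff_frobenius_charP, WittVector.mul_coeff_zero, coeff_zero_iota k hα,
    mul_one] at h
  have h2 : (period (k := k) hα).coeff 0 * ((period (k := k) hα).coeff 0 - 1) = 0 := by
    rw [mul_sub, mul_one, ← sq, h, sub_self]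
  rcases mul_eq_zero.mp h2 with h0 | h1
  · exact absurd h0 hne
  · exact sub_eq_zero.mp h1

/-- `period` is a unit. [folklore] -/
theorem isUnit_period {α : ℤ_[2]} (hα : IsUnit α) : IsUnit (period (k := k) hα) :=
  WittVector.isUnit_of_coeff_zero_ne_zero _ (coeff_zero_period_ne_zero hα)

end Witt

end Summit.BirchSwinnertonDyer.BirchSwinnertonDyer.Theorems.DepletionAtTwo.KEta.WittExistence

end
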